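import Literature.Probability.RandomPlanarGeometry.CritPercSLESimplePath
import Literature.Probability.RandomPlanarGeometry.LocalMartingaleProofs
import Literature.Probability.Process.PathSpaceBorel
import HarnessLib

/-!
# Freezing the past: the simple Markov property of the SLE driving Brownian motion on `C(ℝ≥0, ℝ)`

For functionals of the continuous path `β(ω) = (r ↦ B_r(ω)) ∈ C(ℝ≥0, ℝ)` of the canonical
Brownian motion driving SLE (`Process.brownian` under the pre-Wiener measure,
`isPreBrownianReal_brownian`) we prove the **freezing formula**: for `s ≥ 0` and bounded
measurable `H, Φ : C(ℝ≥0, ℝ) → ℝ`,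

  `E[H(stop_s β) · Φ(β)] = E_ω[H(stop_s β(ω)) · E_{ω₂}[Φ(concat_s(stop_s β(ω), β(ω₂)))]]`

(`integral_mul_eq_integral_integral_concat`): conditionally on the past up to time `s`, the future
is an independent fresh Brownian motion glued to the frozen past. Ingredients: the pathwise identity
`β = concat_s(stop_s β, incr_s β)`; independence of the increment process `incr_s β` from the
stopped path (Mathlib's weak Markov property `IsPreBrownianReal.indepFun_shift`); equality in law of
`incr_s β` and `β` as `C(ℝ≥0, ℝ)`-valued maps (`identDistrib_sleDriving_shift` at `κ = 1`,
transported through `PathSpaceBorel`: the Borel σ-algebra of `C(ℝ≥0, ℝ)` is the pull-back of the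
product σ-algebra); and Fubini on the product of the laws.

The path space is the topic's `C(ℝ≥0, ℝ)` with its Borel σ-algebra (instance arguments
`[MeasurableSpace C(ℝ≥0, ℝ)] [BorelSpace C(ℝ≥0, ℝ)]`, as in `LoewnerHullUnion`), so that path
functionals built by Loewner theory (continuous driving functions) plug in directly. The file lives
in `RandomPlanarGeometry` because its inputs (`isPreBrownianReal_brownian`,
`identDistrib_sleDriving_shift`) and its consumers (the restriction martingale of [LSW] §5) do.

## References

* D. Revuz, M. Yor, *Continuous Martingales and Brownian Motion* (1999), Ch. III Prop. (3.5)
  (simple Markov property) [RevuzYor1999].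
-/

noncomputable section

open MeasureTheory ProbabilityTheory Filter Set Function
open scoped NNReal Topology

namespace Literature.Probability.RandomPlanarGeometry

variable [MeasurableSpace C(ℝ≥0, ℝ)] [BorelSpace C(ℝ≥0, ℝ)]

namespace PathOps

/-! ### Measurability on `C(ℝ≥0, ℝ)` through evaluations -/

/-- Evaluation is measurable. [folklore] -/
theorem measurable_eval (r : ℝ≥0) : Measurable fun υ : C(ℝ≥0, ℝ) ↦ υ r :=
  (continuous_eval_const r).measurable

omit [MeasurableSpace C(ℝ≥0, ℝ)] [BorelSpace C(ℝ≥0, ℝ)] in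
/-- A map into `C(ℝ≥0, ℝ)` is measurable as soon as all its coordinates are (`PathSpaceBorel`).
[folklore] -/
theorem measurable_of_eval {X : Type*} [MeasurableSpace X] {mC : MeasurableSpace C(ℝ≥0, ℝ)} [@BorelSpace C(ℝ≥0, ℝ) _ mC]
    {f : X → C(ℝ≥0, ℝ)} (h : ∀ r, Measurable fun x ↦ f x r) : Measurable[_ , mC] f := by
  have := Process.measurable_continuousMap_of_eval (α := ℝ≥0) (β := ℝ) h
  rwa [← @BorelSpace.measurable_eq C(ℝ≥0, ℝ) _ mC] at this

omit [BorelSpace C(ℝ≥0, ℝ)] in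
/-- The σ-algebra pulled back along a `C(ℝ≥0, ℝ)`-valued map is the one pulled back along its
unbundled version (the Borel σ-algebra of `C(ℝ≥0, ℝ)` is the pull-back of the product σ-algebra).
[folklore] -/
theorem comap_eq_comap_pi [BorelSpace C(ℝ≥0, ℝ)] {X : Type*} (Φ : X → C(ℝ≥0, ℝ)) :
    MeasurableSpace.comap Φ (‹MeasurableSpace C(ℝ≥0, ℝ)›) =
      MeasurableSpace.comap (fun x r ↦ Φ x r) MeasurableSpace.pi := by
  rw [‹BorelSpace C(ℝ≥0, ℝ)›.measurable_eq, Process.borel_continuousMap_eq_iSup_comap_eval,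
    Process.iSup_comap_eval_eq_comap_pi, MeasurableSpace.comap_comp]
  rfl

/-! ### The three maps -/

/-- The path **stopped at `s`**: `r ↦ υ (r ∧ s)`. [folklore] -/
def stop (s : ℝ≥0) (υ : C(ℝ≥0, ℝ)) : C(ℝ≥0, ℝ) :=
  ⟨fun r ↦ υ (min r s), υ.continuous.comp (continuous_id.min continuous_const)⟩

/-- The **increment process after `s`**: `r ↦ υ (s + r) - υ s`. [folklore] -/
def incr (s : ℝ≥0) (υ : C(ℝ≥0, ℝ)) : C(ℝ≥0, ℝ) :=
  ⟨fun r ↦ υ (s + r) - υ s, (υ.continuous.comp (continuous_const.add continuous_id)).sub continuous_const⟩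

/-- **Concatenation at `s`**: follow `p` up to `s`, then add the increments of `q`:
`r ↦ p r` for `r ≤ s`, `r ↦ p s + (q (r - s) - q 0)` for `r ≥ s`. [folklore] -/
def concat (s : ℝ≥0) (pq : C(ℝ≥0, ℝ) × C(ℝ≥0, ℝ)) : C(ℝ≥0, ℝ) :=
  ⟨fun r ↦ if r ≤ s then pq.1 r else pq.1 s + (pq.2 (r - s) - pq.2 0), by
    have h1 : Continuous fun r : ℝ≥0 ↦ pq.1 (min r s) := pq.1.continuous.comp (continuous_id.min continuous_const)
    have h2 : Continuous fun r : ℝ≥0 ↦ pq.1 s + (pq.2 (r - s) - pq.2 0) :=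
      continuous_const.add ((pq.2.continuous.comp (continuous_id.sub continuous_const)).sub continuous_const)
    have heq : (fun r : ℝ≥0 ↦ if r ≤ s then pq.1 r else pq.1 s + (pq.2 (r - s) - pq.2 0)) =
        fun r ↦ if r ≤ s then pq.1 (min r s) else pq.1 s + (pq.2 (r - s) - pq.2 0) := by
      funext r; split_ifs with h
      · rw [min_eq_left h]
      · rfl
    rw [heq]
    refine h1.if_le h2 continuous_id continuous_const fun r hr ↦ ?_
    rw [hr, min_self, tsub_self, sub_self, add_zero]⟩

omit [MeasurableSpace C(ℝ≥0, ℝ)] [BorelSpace C(ℝ≥0, ℝ)] in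
/-- Unfolding `stop`. [folklore] -/
@[simp] theorem stop_apply (s : ℝ≥0) (υ : C(ℝ≥0, ℝ)) (r : ℝ≥0) : stop s υ r = υ (min r s) := rfl

omit [MeasurableSpace C(ℝ≥0, ℝ)] [BorelSpace C(ℝ≥0, ℝ)] in
/-- Unfolding `incr`. [folklore] -/
@[simp] theorem incr_apply (s : ℝ≥0) (υ : C(ℝ≥0, ℝ)) (r : ℝ≥0) : incr s υ r = υ (s + r) - υ s := rfl

omit [MeasurableSpace C(ℝ≥0, ℝ)] [BorelSpace C(ℝ≥0, ℝ)] in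
/-- Unfolding `concat`. [folklore] -/
theorem concat_apply (s : ℝ≥0) (p q : C(ℝ≥0, ℝ)) (r : ℝ≥0) :
    concat s (p, q) r = if r ≤ s then p r else p s + (q (r - s) - q 0) := rfl

/-- `stop` is measurable. [folklore] -/
theorem measurable_stop (s : ℝ≥0) : Measurable (stop s) :=
  measurable_of_eval fun _ ↦ measurable_eval _

/-- `incr` is measurable. [folklore] -/
theorem measurable_incr (s : ℝ≥0) : Measurable (incr s) :=
  measurable_of_eval fun _ ↦ (measurable_eval _).sub (measurable_eval _)

/-- `concat` is measurable. [folklore] -/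
theorem measurable_concat (s : ℝ≥0) : Measurable (concat s) := by
  refine measurable_of_eval fun r ↦ ?_
  by_cases h : r ≤ s
  · have : (fun x : C(ℝ≥0, ℝ) × C(ℝ≥0, ℝ) ↦ concat s x r) = fun x ↦ x.1 r := by
      funext x; rw [show x = (x.1, x.2) from rfl, concat_apply, if_pos h]
    rw [this]; exact (measurable_eval r).comp measurable_fst
  · have : (fun x : C(ℝ≥0, ℝ) × C(ℝ≥0, ℝ) ↦ concat s x r) = fun x ↦ x.1 s + (x.2 (r - s) - x.2 0) := by
      funext x; rw [show x = (x.1, x.2) from rfl, concat_apply, if_neg h]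
    rw [this]
    exact ((measurable_eval s).comp measurable_fst).add
      (((measurable_eval _).comp measurable_snd).sub ((measurable_eval 0).comp measurable_snd))

omit [MeasurableSpace C(ℝ≥0, ℝ)] [BorelSpace C(ℝ≥0, ℝ)] in
/-- **A path is its past glued to its increments**: `concat_s (stop_s υ, incr_s υ) = υ`. [folklore] -/
theorem concat_stop_incr (s : ℝ≥0) (υ : C(ℝ≥0, ℝ)) : concat s (stop s υ, incr s υ) = υ := by
  ext r
  rw [concat_apply]
  split_ifs with h
  · rw [stop_apply, min_eq_left h]
  · simp only [stop_apply, min_self, incr_apply, add_zero, sub_self, sub_zero]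
    rw [add_tsub_cancel_of_le (not_le.1 h).le]; ring

omit [MeasurableSpace C(ℝ≥0, ℝ)] [BorelSpace C(ℝ≥0, ℝ)] in
/-- On `[0, s]` the concatenation is the first path. [folklore] -/
theorem concat_apply_of_le (s : ℝ≥0) (p q : C(ℝ≥0, ℝ)) {r : ℝ≥0} (hr : r ≤ s) : concat s (p, q) r = p r := by
  rw [concat_apply, if_pos hr]

omit [MeasurableSpace C(ℝ≥0, ℝ)] [BorelSpace C(ℝ≥0, ℝ)] in
/-- After `s` the concatenation adds the increments of the second path (when it starts at `0`).
[folklore] -/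
theorem concat_apply_add (s : ℝ≥0) (p q : C(ℝ≥0, ℝ)) (hq : q 0 = 0) (r : ℝ≥0) :
    concat s (p, q) (s + r) = p s + q r := by
  rw [concat_apply]
  split_ifs with h
  · have : r = 0 := le_antisymm (by simpa using h) bot_le
    rw [this, add_zero, hq, add_zero]
  · rw [hq, sub_zero, add_tsub_cancel_left]

end PathOps

open PathOps

/-! ### The Brownian path as a `C(ℝ≥0, ℝ)`-valued random variable -/

/-- The canonical Brownian motion as a random continuous path (the bundled version of
`brownianPath`). [folklore] -/
def brownianCPath (ω : ℝ≥0 → ℝ) : C(ℝ≥0, ℝ) := ⟨fun r ↦ Process.brownian r ω, Process.continuous_brownian ω⟩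

omit [MeasurableSpace C(ℝ≥0, ℝ)] [BorelSpace C(ℝ≥0, ℝ)] in
/-- Unfolding. [folklore] -/
@[simp] theorem brownianCPath_apply (ω : ℝ≥0 → ℝ) (r : ℝ≥0) : brownianCPath ω r = Process.brownian r ω := rfl

/-- The random path is measurable. [folklore] -/
theorem measurable_brownianCPath : Measurable brownianCPath :=
  measurable_of_eval fun r ↦ Process.measurable_brownian r

omit [MeasurableSpace C(ℝ≥0, ℝ)] [BorelSpace C(ℝ≥0, ℝ)] in
/-- The random path starts at `0`. [folklore] -/
theorem brownianCPath_zero (ω : ℝ≥0 → ℝ) : brownianCPath ω 0 = 0 := by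
  rw [brownianCPath_apply, Process.brownian_zero]; rfl

/-- **The increments after `s` are independent of the stopped path** (Mathlib's weak Markov property:
the increment process is independent of the restriction of the path to `[0, s]`, and the stopped
path is a measurable function of that restriction). [cite: RevuzYor1999, Ch. III Prop. (3.5)] -/
theorem indepFun_incr_stop (s : ℝ≥0) :
    IndepFun (fun ω ↦ incr s (brownianCPath ω)) (fun ω ↦ stop s (brownianCPath ω)) Process.preWienerMeasure := by
  have h0 := isPreBrownianReal_brownian.indepFun_shift s
  rw [IndepFun_iff_Indep] at h0 ⊢
  -- the increment map generates the σ-algebra of Mathlib's increment process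
  have h1 : MeasurableSpace.comap (fun ω ↦ incr s (brownianCPath ω)) ‹MeasurableSpace C(ℝ≥0, ℝ)› =
      MeasurableSpace.comap (fun ω t ↦ Process.brownian (s + t) ω - Process.brownian s ω) inferInstance := by
    rw [comap_eq_comap_pi]; rfl
  -- the stopped path is measurable with respect to the restriction to `[0, s]`
  have h2 : MeasurableSpace.comap (fun ω ↦ stop s (brownianCPath ω)) ‹MeasurableSpace C(ℝ≥0, ℝ)› ≤
      MeasurableSpace.comap (fun ω (t : Set.Iic s) ↦ Process.brownian t ω) inferInstance := by
    set π : (ℝ≥0 → ℝ) → (Set.Iic s → ℝ) := fun ω t ↦ Process.brownian t ω with hπ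
    have hπm : Measurable[MeasurableSpace.comap π inferInstance] π := comap_measurable π
    have hmeas : Measurable[MeasurableSpace.comap π inferInstance] fun ω ↦ stop s (brownianCPath ω) := by
      refine @measurable_of_eval _ (MeasurableSpace.comap π inferInstance) _ _ _ fun r ↦ ?_
      have : (fun ω ↦ stop s (brownianCPath ω) r) = (fun f : Set.Iic s → ℝ ↦ f ⟨min r s, min_le_right r s⟩) ∘ π := rfl
      rw [this]
      exact (measurable_pi_apply _).comp hπm
    exact hmeas.comap_le
  rw [h1]
  exact indep_of_indep_of_le_right h0 h2

/-- **The increment process has the law of the Brownian path**, as `C(ℝ≥0, ℝ)`-valued maps (the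
laws on the product space agree, `identDistrib_sleDriving_shift` at `κ = 1`, and the Borel
σ-algebra of `C(ℝ≥0, ℝ)` is pulled back from the product space). [cite: RevuzYor1999, Ch. III Prop. (3.5)] -/
theorem identDistrib_incr (s : ℝ≥0) :
    IdentDistrib (fun ω ↦ incr s (brownianCPath ω)) brownianCPath Process.preWienerMeasure Process.preWienerMeasure := by
  have hval : IdentDistrib (fun ω r ↦ incr s (brownianCPath ω) r) (fun ω r ↦ brownianCPath ω r)
      Process.preWienerMeasure Process.preWienerMeasure := by
    have h := (identDistrib_sleDriving_shift (κ := 1) s).symm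
    have e1 : (fun ω t ↦ sleDriving 1 ω (s + t) - sleDriving 1 ω s) = fun ω r ↦ incr s (brownianCPath ω) r := by
      funext ω t; simp [sleDriving_apply]
    have e2 : (fun ω t ↦ sleDriving 1 ω t) = fun ω r ↦ brownianCPath ω r := by
      funext ω t; simp [sleDriving_apply]
    rw [e1, e2] at h
    exact h
  have hm1 : Measurable fun ω ↦ incr s (brownianCPath ω) := (measurable_incr s).comp measurable_brownianCPath
  refine ⟨hm1.aemeasurable, measurable_brownianCPath.aemeasurable, ?_⟩
  ext S hS
  have hS' : MeasurableSet[MeasurableSpace.comap (fun (f : C(ℝ≥0, ℝ)) (a : ℝ≥0) ↦ f a) MeasurableSpace.pi] S := by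
    rw [← Process.iSup_comap_eval_eq_comap_pi, ← Process.borel_continuousMap_eq_iSup_comap_eval,
      ← ‹BorelSpace C(ℝ≥0, ℝ)›.measurable_eq]
    exact hS
  obtain ⟨T, hT, rfl⟩ := MeasurableSpace.measurableSet_comap.1 hS'
  rw [Measure.map_apply hm1 hS, Measure.map_apply measurable_brownianCPath hS]
  have h1 : Measure.map (fun ω r ↦ incr s (brownianCPath ω) r) Process.preWienerMeasure T =
      Measure.map (fun ω r ↦ brownianCPath ω r) Process.preWienerMeasure T := by rw [hval.map_eq]
  have hm2 : Measurable fun ω r ↦ incr s (brownianCPath ω) r := measurable_pi_iff.2 fun r ↦ (measurable_eval r).comp hm1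
  have hm3 : Measurable fun ω r ↦ brownianCPath ω r := measurable_pi_iff.2 fun r ↦ Process.measurable_brownian r
  rw [Measure.map_apply hm2 hT, Measure.map_apply hm3 hT] at h1
  exact h1

/-! ### The freezing formula -/

/-- **Freezing the past (simple Markov property)**: for bounded measurable `H, Φ : C(ℝ≥0, ℝ) → ℝ`,
`E[H(stop_s β) Φ(β)] = E_ω[H(stop_s β(ω)) · E_{ω₂}[Φ(concat_s(stop_s β(ω), β(ω₂)))]]`.
[cite: RevuzYor1999, Ch. III Prop. (3.5)] -/
theorem integral_mul_eq_integral_integral_concat (s : ℝ≥0) {H Φ : C(ℝ≥0, ℝ) → ℝ} (hHm : Measurable H)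
    (hΦm : Measurable Φ) {C : ℝ} (hH : ∀ p, |H p| ≤ C) (hΦ : ∀ p, |Φ p| ≤ C) :
    ∫ ω, H (stop s (brownianCPath ω)) * Φ (brownianCPath ω) ∂Process.preWienerMeasure =
      ∫ ω, H (stop s (brownianCPath ω)) *
        (∫ ω₂, Φ (concat s (stop s (brownianCPath ω), brownianCPath ω₂)) ∂Process.preWienerMeasure)
          ∂Process.preWienerMeasure := by
  haveI := isProbabilityMeasure_preWienerMeasure'
  set X : (ℝ≥0 → ℝ) → C(ℝ≥0, ℝ) := fun ω ↦ stop s (brownianCPath ω) with hX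
  set Yv : (ℝ≥0 → ℝ) → C(ℝ≥0, ℝ) := fun ω ↦ incr s (brownianCPath ω) with hYv
  have hXm : Measurable X := (measurable_stop s).comp measurable_brownianCPath
  have hYm : Measurable Yv := (measurable_incr s).comp measurable_brownianCPath
  set F : C(ℝ≥0, ℝ) × C(ℝ≥0, ℝ) → ℝ := fun pq ↦ H pq.1 * Φ (concat s pq) with hF
  have hFm : Measurable F := (hHm.comp measurable_fst).mul (hΦm.comp (measurable_concat s))
  have hC0 : 0 ≤ C := (abs_nonneg _).trans (hH (X (Classical.arbitrary _)))
  have hFb : ∀ pq, |F pq| ≤ C * C := fun pq ↦ by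
    rw [hF, abs_mul]; exact mul_le_mul (hH _) (hΦ _) (abs_nonneg _) hC0
  -- (1) the left side is `∫ F (X, Yv)`
  have h1 : (fun ω ↦ H (stop s (brownianCPath ω)) * Φ (brownianCPath ω)) = fun ω ↦ F (X ω, Yv ω) := by
    funext ω; simp only [hF, hX, hYv, concat_stop_incr]
  rw [h1]
  -- (2) push forward to the product of the laws
  have hind := indepFun_incr_stop s
  have hpair : Measure.map (fun ω ↦ (X ω, Yv ω)) Process.preWienerMeasure =
      (Measure.map X Process.preWienerMeasure).prod (Measure.map Yv Process.preWienerMeasure) :=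
    (indepFun_iff_map_prod_eq_prod_map_map hXm.aemeasurable hYm.aemeasurable).1 hind.symm
  haveI : IsProbabilityMeasure (Measure.map X Process.preWienerMeasure) := Measure.isProbabilityMeasure_map hXm.aemeasurable
  haveI : IsProbabilityMeasure (Measure.map Yv Process.preWienerMeasure) := Measure.isProbabilityMeasure_map hYm.aemeasurable
  have hFint : ∀ (μ : Measure (C(ℝ≥0, ℝ) × C(ℝ≥0, ℝ))) [IsFiniteMeasure μ], Integrable F μ := fun μ _ ↦
    (integrable_const (C * C)).mono' hFm.aestronglyMeasurable (Eventually.of_forall fun pq ↦ by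
      rw [Real.norm_eq_abs]; exact hFb pq)
  have h2 : ∫ ω, F (X ω, Yv ω) ∂Process.preWienerMeasure =
      ∫ pq, F pq ∂(Measure.map (fun ω ↦ (X ω, Yv ω)) Process.preWienerMeasure) := by
    rw [integral_map (hXm.prodMk hYm).aemeasurable hFm.aestronglyMeasurable]
  rw [h2, hpair, integral_prod F (hFint _)]
  -- (3) replace the law of the increments by the law of the path, and pull back
  rw [(identDistrib_incr s).map_eq]
  have h3 : ∀ p : C(ℝ≥0, ℝ), ∫ q, F (p, q) ∂(Measure.map brownianCPath Process.preWienerMeasure) =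
      ∫ ω₂, F (p, brownianCPath ω₂) ∂Process.preWienerMeasure := fun p ↦ by
    rw [integral_map measurable_brownianCPath.aemeasurable]
    exact (hFm.comp (measurable_const.prodMk measurable_id)).aestronglyMeasurable
  simp_rw [h3]
  rw [integral_map hXm.aemeasurable]
  · simp only [hF, hX]
    congr 1; funext ω
    rw [← integral_const_mul]
  · refine (Measurable.stronglyMeasurable ?_).aestronglyMeasurable
    exact (hFm.comp (measurable_fst.prodMk (measurable_brownianCPath.comp measurable_snd))).stronglyMeasurable.integral_prod_right'
      |>.measurable

end Literature.Probability.RandomPlanarGeometry
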